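import Summits.ResolutionOfSingularities.ResolutionOfSingularities.Theorems.FrobeniusLadderFInjectiveMacaulayficationFDSpecimen
import HarnessLib

/-!
# (W-TD) BED D, STOREY 2 (D-2): the germ `G = Y₃² + Y₁³ + Y₂³ + (1+Y₃)(Y₄Y₅⁴ + Y₄²Y₅)` (char 2) at the bad point `P` of storey 1 — prime, no variable vanishes, isolated,
# NOT F-pure at the origin, and ★ WEAKLY NON-DEGENERATE along every positive weight (so the weak class row (B′) applies at `P` on Σ_G-refining cover data)
# (crux `FInjectiveMacaulayfication` stmt-ResolutionOfSingularities-15315, chain w45a; res-L1-w45a-plan-1 RULING R21.15 (2) (D-2) «stub-3: `…FDStorey2Specimen` at (V(G), P): hWND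
# on all 31 faces by a good-support/face-table lemma, hreg = isolated in the chart, prime, hXne»; G = res-L1-w45a-tri-2 g17's storey-2 local equation (memo `Q13-fD-tri2.md` §9:
# chart 277 of Σ_D^{𝔪K}, `g = y₃y₄y₅⁴ + y₃y₄²y₅ + y₁³ + y₂³ + y₃² + 1`, `P = (0,0,1,0,0)`, `Y₃ := y₃ + 1`); seat res-L1-w45a-stub-3 g11)

[OURS · L1 W4.5a] Support file (`--supports stmt-ResolutionOfSingularities-15315 --as helper`); def-free, unconditional; replaces the role of NO printed item; NOT a statement
of the manuscript; AI-written (AI review is weaker than expert review).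

`X 0..X 4 = Y₁..Y₅`; `f = X2² + X0³ + X1³ + X3·X4⁴ + X3²·X4 + X2·X3·X4⁴ + X2·X3²·X4` (= `X2² + X0³ + X1³ + (1 + X2)(X3X4⁴ + X3²X4)`, `f_eq_factored`), `char k = 2` (ANY field).
* §1 `f_eq_factored`, `pderiv_zero_f` (Y₁²) / `pderiv_one_f` (Y₂²) / `pderiv_two_f` (Y₄Y₅⁴ + Y₄²Y₅) / `pderiv_three_f` ((1+Y₃)Y₅⁴) / `pderiv_four_f` ((1+Y₃)Y₄²), `constantCoeff_f`,
  `prime_swapped` + ★ `prime_f` (swap Y₃ ↔ Y₅; `T² + C(b)T + C(c)`, `b = Y₄Y₅⁴+Y₄²Y₅`, `c = Y₁³+Y₂³+b`, Eisenstein-type at `(1,1,0,0)`, `∂_{Y₁} c = 1`), `isPrime_span_f`, `f_not_mem_span_X`,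
  ★ `mk_X_ne_zero` (hXne), ★ `regular_off_vertex` (hreg: Jacobian with the unit/`Y₃` dichotomy — `1 + Y₃ ∈ P` forces `Y₃ ∈ P` then `1 ∈ P`), `isIntegral_g`;
* §2 (H1)–(H5) at the origin (`isClosed_vertex`, `vertex_not_mem_regularLocus`, `ringKrullDim_stalk_vertex = 4`, `regular_of_ne_vertex`, `regular_off_closedPoint_vertex`,
  `cmCl_Spec_stalk_vertex`); §3 `f_mem_bracket` (`f ∈ 𝔪^{[2]}` termwise) + ★ `storey2_vertex_not_fullCl`;
* (sequel `…FDStorey2WND`: ★★ `weaklyNondegenerate_storey2` — hWND along EVERY positive weight.)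
[folklore mathematics, OURS as a certificate; cite: Hartshorne1977, I Thm. 5.1; Matsumura1987, Thm. 17.4; Fedder1983, Prop. 1.7; BoubakriGreuelMarkwig2010, §3]
-/

-- single-problem summit: the doubled namespace component is forced
set_option linter.dupNamespace false

noncomputable section

open AlgebraicGeometry CategoryTheory Literature.AlgebraicGeometry.Resolution TopologicalSpace IsLocalRing MvPolynomial

namespace Summit.ResolutionOfSingularities.ResolutionOfSingularities.Theorems.FInjectiveMacaulayfication.FDStorey2Specimen

open Summit.ResolutionOfSingularities.ResolutionOfSingularities.Theorems.FInjectiveMacaulayfication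
open SliceableCentre GermForm GermOfGlobalBlowup FCentreE1RungZero

/-! ## §1 The polynomial, derivatives, primality, hXne, hreg -/

/-- The factored form of tri-2's memo. [plumbing] -/
theorem f_eq_factored (k : Type) [Field k] (f : MvPolynomial (Fin 5) k) (hf : f = X 2 ^ 2 + X 0 ^ 3 + X 1 ^ 3 + X 3 * X 4 ^ 4 + X 3 ^ 2 * X 4 + X 2 * X 3 * X 4 ^ 4 + X 2 * X 3 ^ 2 * X 4) :
    f = X 2 ^ 2 + X 0 ^ 3 + X 1 ^ 3 + (1 + X 2) * (X 3 * X 4 ^ 4 + X 3 ^ 2 * X 4) := by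
  rw [hf]; ring

/-- `∂f/∂Y₁ = 3Y₁² = Y₁²`. [folklore] -/
theorem pderiv_zero_f (k : Type) [Field k] [CharP k 2] (f : MvPolynomial (Fin 5) k) (hf : f = X 2 ^ 2 + X 0 ^ 3 + X 1 ^ 3 + X 3 * X 4 ^ 4 + X 3 ^ 2 * X 4 + X 2 * X 3 * X 4 ^ 4 + X 2 * X 3 ^ 2 * X 4) : pderiv 0 f = X 0 ^ 2 := by
  obtain ⟨h3, -, -, -, -⟩ := FDSpecimen.casts_char2 k
  rw [hf]
  simp only [map_add, Derivation.leibniz, pderiv_pow, pderiv_X_self, smul_eq_mul, pderiv_X_of_ne (show (1 : Fin 5) ≠ 0 by decide),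
    pderiv_X_of_ne (show (2 : Fin 5) ≠ 0 by decide), pderiv_X_of_ne (show (3 : Fin 5) ≠ 0 by decide), pderiv_X_of_ne (show (4 : Fin 5) ≠ 0 by decide),
    mul_zero, mul_one, add_zero, zero_add]
  push_cast
  rw [h3]
  ring

/-- `∂f/∂Y₂ = Y₂²`. [folklore] -/
theorem pderiv_one_f (k : Type) [Field k] [CharP k 2] (f : MvPolynomial (Fin 5) k) (hf : f = X 2 ^ 2 + X 0 ^ 3 + X 1 ^ 3 + X 3 * X 4 ^ 4 + X 3 ^ 2 * X 4 + X 2 * X 3 * X 4 ^ 4 + X 2 * X 3 ^ 2 * X 4) : pderiv 1 f = X 1 ^ 2 := by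
  obtain ⟨h3, -, -, -, -⟩ := FDSpecimen.casts_char2 k
  rw [hf]
  simp only [map_add, Derivation.leibniz, pderiv_pow, pderiv_X_self, smul_eq_mul, pderiv_X_of_ne (show (0 : Fin 5) ≠ 1 by decide),
    pderiv_X_of_ne (show (2 : Fin 5) ≠ 1 by decide), pderiv_X_of_ne (show (3 : Fin 5) ≠ 1 by decide), pderiv_X_of_ne (show (4 : Fin 5) ≠ 1 by decide),
    mul_zero, mul_one, add_zero, zero_add]
  push_cast
  rw [h3]
  ring

/-- `∂f/∂Y₃ = 2Y₃ + Y₄Y₅⁴ + Y₄²Y₅ = Y₄Y₅⁴ + Y₄²Y₅`. [folklore] -/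
theorem pderiv_two_f (k : Type) [Field k] [CharP k 2] (f : MvPolynomial (Fin 5) k) (hf : f = X 2 ^ 2 + X 0 ^ 3 + X 1 ^ 3 + X 3 * X 4 ^ 4 + X 3 ^ 2 * X 4 + X 2 * X 3 * X 4 ^ 4 + X 2 * X 3 ^ 2 * X 4) : pderiv 2 f = X 3 * X 4 ^ 4 + X 3 ^ 2 * X 4 := by
  have h2 : (2 : MvPolynomial (Fin 5) k) = 0 := (FermatCubicConeChar2.two_three k (n := 5)).1
  rw [hf]
  simp only [map_add, Derivation.leibniz, pderiv_pow, pderiv_X_self, smul_eq_mul, pderiv_X_of_ne (show (0 : Fin 5) ≠ 2 by decide),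
    pderiv_X_of_ne (show (1 : Fin 5) ≠ 2 by decide), pderiv_X_of_ne (show (3 : Fin 5) ≠ 2 by decide), pderiv_X_of_ne (show (4 : Fin 5) ≠ 2 by decide),
    mul_zero, mul_one, add_zero, zero_add]
  push_cast
  rw [h2]
  ring

/-- `∂f/∂Y₄ = (1 + Y₃)Y₅⁴`. [folklore] -/
theorem pderiv_three_f (k : Type) [Field k] [CharP k 2] (f : MvPolynomial (Fin 5) k) (hf : f = X 2 ^ 2 + X 0 ^ 3 + X 1 ^ 3 + X 3 * X 4 ^ 4 + X 3 ^ 2 * X 4 + X 2 * X 3 * X 4 ^ 4 + X 2 * X 3 ^ 2 * X 4) : pderiv 3 f = (1 + X 2) * X 4 ^ 4 := by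
  have h2 : (2 : MvPolynomial (Fin 5) k) = 0 := (FermatCubicConeChar2.two_three k (n := 5)).1
  rw [hf]
  simp only [map_add, Derivation.leibniz, pderiv_pow, pderiv_X_self, smul_eq_mul, pderiv_X_of_ne (show (0 : Fin 5) ≠ 3 by decide),
    pderiv_X_of_ne (show (1 : Fin 5) ≠ 3 by decide), pderiv_X_of_ne (show (2 : Fin 5) ≠ 3 by decide), pderiv_X_of_ne (show (4 : Fin 5) ≠ 3 by decide),
    mul_zero, mul_one, add_zero, zero_add]
  push_cast
  rw [h2]
  ring

/-- `∂f/∂Y₅ = (1 + Y₃)Y₄²`. [folklore] -/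
theorem pderiv_four_f (k : Type) [Field k] [CharP k 2] (f : MvPolynomial (Fin 5) k) (hf : f = X 2 ^ 2 + X 0 ^ 3 + X 1 ^ 3 + X 3 * X 4 ^ 4 + X 3 ^ 2 * X 4 + X 2 * X 3 * X 4 ^ 4 + X 2 * X 3 ^ 2 * X 4) : pderiv 4 f = (1 + X 2) * X 3 ^ 2 := by
  obtain ⟨-, h4, -, -, -⟩ := FDSpecimen.casts_char2 k
  rw [hf]
  simp only [map_add, Derivation.leibniz, pderiv_pow, pderiv_X_self, smul_eq_mul, pderiv_X_of_ne (show (0 : Fin 5) ≠ 4 by decide),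
    pderiv_X_of_ne (show (1 : Fin 5) ≠ 4 by decide), pderiv_X_of_ne (show (2 : Fin 5) ≠ 4 by decide), pderiv_X_of_ne (show (3 : Fin 5) ≠ 4 by decide),
    mul_zero, mul_one, add_zero, zero_add]
  push_cast
  rw [h4]
  ring

/-- `f` has no constant term. [folklore] -/
theorem constantCoeff_f (k : Type) [Field k] (f : MvPolynomial (Fin 5) k) (hf : f = X 2 ^ 2 + X 0 ^ 3 + X 1 ^ 3 + X 3 * X 4 ^ 4 + X 3 ^ 2 * X 4 + X 2 * X 3 * X 4 ^ 4 + X 2 * X 3 ^ 2 * X 4) : constantCoeff f = 0 := by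
  rw [hf]
  simp [constantCoeff_X]

/-- Primality of the variable-swapped polynomial (`Y₃ ↔ Y₅`): as `T² + C(b)·T + C(c)` in `T = X 4` over `k[X 0..X 3]` with `b = X3·X2⁴ + X3²·X2`,
`c = X0³ + X1³ + b`, Eisenstein-type at `(1,1,0,0)` (`b = 0`, `c = 1 + 1 = 0`, `∂_{X0} c = 3X0² = 1 ≠ 0`). [folklore] -/
theorem prime_swapped (k : Type) [Field k] [CharP k 2] (g : MvPolynomial (Fin 5) k)
    (hg : g = X 4 ^ 2 + X 0 ^ 3 + X 1 ^ 3 + X 3 * X 2 ^ 4 + X 3 ^ 2 * X 2 + X 4 * X 3 * X 2 ^ 4 + X 4 * X 3 ^ 2 * X 2) : Prime g := by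
  set e : MvPolynomial (Fin 5) k ≃+* Polynomial (MvPolynomial (Fin 4) k) :=
    ((renameEquiv k (_root_.finRotate 5)).trans (finSuccEquiv k 4)).toRingEquiv with he_def
  have hrot4 : (_root_.finRotate 5) (4 : Fin 5) = 0 := by decide
  have hrot : ∀ j : Fin 4, (_root_.finRotate 5) (Fin.castSucc j) = j.succ := by decide
  have he4 : e (X 4) = Polynomial.X := by
    show finSuccEquiv k 4 (rename _ (X 4)) = _
    rw [rename_X, hrot4]; exact finSuccEquiv_X_zero
  have hej : ∀ j : Fin 4, e (X (Fin.castSucc j)) = Polynomial.C (X j) := fun j => by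
    show finSuccEquiv k 4 (rename _ (X (Fin.castSucc j))) = _
    rw [rename_X, hrot j]; exact finSuccEquiv_X_succ (j := j)
  set b : MvPolynomial (Fin 4) k := X 3 * X 2 ^ 4 + X 3 ^ 2 * X 2 with hb
  set c : MvPolynomial (Fin 4) k := X 0 ^ 3 + X 1 ^ 3 + X 3 * X 2 ^ 4 + X 3 ^ 2 * X 2 with hc
  have hef : e g = Polynomial.X ^ 2 + Polynomial.C b * Polynomial.X + Polynomial.C c := by
    rw [hg]
    simp only [map_add, map_mul, map_pow, he4,
      show (0 : Fin 5) = Fin.castSucc (0 : Fin 4) from rfl, show (1 : Fin 5) = Fin.castSucc (1 : Fin 4) from rfl,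
      show (2 : Fin 5) = Fin.castSucc (2 : Fin 4) from rfl, show (3 : Fin 5) = Fin.castSucc (3 : Fin 4) from rfl, hej, hb, hc]
    ring
  set a : Fin 4 → k := ![1, 1, 0, 0] with ha
  have h2 : (2 : k) = 0 := by simpa using CharP.cast_eq_zero k 2
  have h3 : (3 : k) = 1 := by
    calc (3 : k) = 2 + 1 := by norm_num
      _ = 1 := by rw [h2]; ring
  have hba : MvPolynomial.eval a b = 0 := by
    rw [hb]
    simp only [map_add, map_mul, map_pow, eval_X, ha]
    simp [Matrix.cons_val]
  have hca : MvPolynomial.eval a c = 0 := by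
    rw [hc]
    simp only [map_add, map_pow, map_mul, eval_X, ha, Matrix.cons_val_zero, Matrix.cons_val_one]
    simp only [Matrix.cons_val, one_pow, zero_pow (by norm_num : (4 : ℕ) ≠ 0), zero_pow (by norm_num : (2 : ℕ) ≠ 0), mul_zero, add_zero]
    rw [show (1 : k) + 1 = 2 by norm_num, h2]
  have hder : MvPolynomial.eval a (pderiv 0 c) ≠ 0 := by
    have e1 : pderiv 0 c = 3 * X 0 ^ 2 := by
      rw [hc]
      simp only [map_add, Derivation.leibniz, pderiv_pow, pderiv_X_self, smul_eq_mul, pderiv_X_of_ne (show (1 : Fin 4) ≠ 0 by decide),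
        pderiv_X_of_ne (show (2 : Fin 4) ≠ 0 by decide), pderiv_X_of_ne (show (3 : Fin 4) ≠ 0 by decide), mul_zero, add_zero, mul_one]
      push_cast
      ring
    rw [e1, map_mul, map_pow, eval_X, ha]
    simp only [Matrix.cons_val_zero, one_pow, mul_one]
    rw [map_ofNat, h3]
    exact one_ne_zero
  have hirr : Irreducible (e g) := by
    rw [hef]
    exact Literature.AlgebraicGeometry.Motives.SmoothHypersurface.irreducible_X_pow_add_C_mul_X_add_C (d := 2) le_rfl b c a hba hca 0 hder
  exact (MulEquiv.prime_iff e).mp hirr.prime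

/-- **`f` is PRIME** (any field of characteristic 2): swap `Y₃ ↔ Y₅` (`X 2 ↔ X 4`) and apply `prime_swapped`. [folklore] -/
theorem prime_f (k : Type) [Field k] [CharP k 2] (f : MvPolynomial (Fin 5) k) (hf : f = X 2 ^ 2 + X 0 ^ 3 + X 1 ^ 3 + X 3 * X 4 ^ 4 + X 3 ^ 2 * X 4 + X 2 * X 3 * X 4 ^ 4 + X 2 * X 3 ^ 2 * X 4) : Prime f := by
  set s : MvPolynomial (Fin 5) k ≃+* MvPolynomial (Fin 5) k := (renameEquiv k (Equiv.swap (2 : Fin 5) 4)).toRingEquiv with hs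
  have hsX : ∀ j : Fin 5, s (X j) = X (Equiv.swap (2 : Fin 5) 4 j) := fun j => by
    show rename _ (X j) = _
    rw [rename_X]
  have hsf : s f = X 4 ^ 2 + X 0 ^ 3 + X 1 ^ 3 + X 3 * X 2 ^ 4 + X 3 ^ 2 * X 2 + X 4 * X 3 * X 2 ^ 4 + X 4 * X 3 ^ 2 * X 2 := by
    rw [hf]
    simp only [map_add, map_mul, map_pow, hsX]
    simp [Equiv.swap_apply_def]
  exact (MulEquiv.prime_iff s).mp (prime_swapped k (s f) hsf)

/-- `(f)` is a prime ideal. [plumbing] -/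
theorem isPrime_span_f (k : Type) [Field k] [CharP k 2] (f : MvPolynomial (Fin 5) k) (hf : f = X 2 ^ 2 + X 0 ^ 3 + X 1 ^ 3 + X 3 * X 4 ^ 4 + X 3 ^ 2 * X 4 + X 2 * X 3 * X 4 ^ 4 + X 2 * X 3 ^ 2 * X 4) : (Ideal.span {f}).IsPrime :=
  (Ideal.span_singleton_prime (prime_f k f hf).ne_zero).mpr (prime_f k f hf)

/-- `f ∉ (Xᵢ)` for every `i` (evaluate at `e_{Y₁}`, resp. `e_{Y₂}` for `i = 0`). [folklore] -/
theorem f_not_mem_span_X (k : Type) [Field k] (f : MvPolynomial (Fin 5) k) (hf : f = X 2 ^ 2 + X 0 ^ 3 + X 1 ^ 3 + X 3 * X 4 ^ 4 + X 3 ^ 2 * X 4 + X 2 * X 3 * X 4 ^ 4 + X 2 * X 3 ^ 2 * X 4) :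
    ∀ i : Fin 5, f ∉ Ideal.span {(X i : MvPolynomial (Fin 5) k)} := by
  intro i h
  rw [Ideal.mem_span_singleton] at h
  obtain ⟨c, hc⟩ := h
  by_cases hi : i = 0
  · subst hi
    have := congrArg (MvPolynomial.eval (Pi.single 1 1 : Fin 5 → k)) hc
    rw [hf] at this
    simp at this
  · have := congrArg (MvPolynomial.eval (Pi.single 0 1 : Fin 5 → k)) hc
    rw [hf] at this
    have h1 : (Pi.single 0 1 : Fin 5 → k) i = 0 := by rw [Pi.single_apply, if_neg hi]
    simp [h1] at this

/-- ★ **No variable vanishes in `k[X]/(f)`** (`hXne`). [plumbing] -/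
theorem mk_X_ne_zero (k : Type) [Field k] [CharP k 2] (f : MvPolynomial (Fin 5) k) (hf : f = X 2 ^ 2 + X 0 ^ 3 + X 1 ^ 3 + X 3 * X 4 ^ 4 + X 3 ^ 2 * X 4 + X 2 * X 3 * X 4 ^ 4 + X 2 * X 3 ^ 2 * X 4) (i : Fin 5) :
    Ideal.Quotient.mk (Ideal.span {f}) (X i) ≠ 0 := fun h0 =>
  PrimeTransfer.X_not_mem_span_of_isPrime (isPrime_span_f k f hf) (f_not_mem_span_X k f hf i) (Ideal.Quotient.eq_zero_iff_mem.mp h0)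

/-- ★ **`(k[X]/(f))_P` is regular at every prime `P ⊉ 𝔪`** (`hreg`): if `Y₁` or `Y₂` misses `P`, its square is the partial; else `1 + Y₃ ∉ P` (otherwise `Y₃² = f − … ∈ P`,
`Y₃ ∈ P`, `1 ∈ P`), so `Y₄ ∉ P ⇒ ∂_{Y₅} f = (1+Y₃)Y₄² ∉ P` and `Y₅ ∉ P ⇒ ∂_{Y₄} f = (1+Y₃)Y₅⁴ ∉ P`; all four in `P` would force `Y₃ ∈ P`. [cite: Hartshorne1977, I Thm. 5.1] -/
theorem regular_off_vertex (k : Type) [Field k] [CharP k 2] (f : MvPolynomial (Fin 5) k) (hf : f = X 2 ^ 2 + X 0 ^ 3 + X 1 ^ 3 + X 3 * X 4 ^ 4 + X 3 ^ 2 * X 4 + X 2 * X 3 * X 4 ^ 4 + X 2 * X 3 ^ 2 * X 4)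
    (P : Ideal (MvPolynomial (Fin 5) k ⧸ Ideal.span {f})) [P.IsPrime]
    (hP : ¬ Ideal.span (Set.range fun j : Fin 5 => Ideal.Quotient.mk (Ideal.span {f}) (X j)) ≤ P) :
    IsRegularLocalRing (Localization.AtPrime P) := by
  have hP' : (P.comap (Ideal.Quotient.mk (Ideal.span {f}))).IsPrime := Ideal.comap_isPrime _ _
  set P' := P.comap (Ideal.Quotient.mk (Ideal.span {f})) with hP'def
  have hfP : f ∈ P' := FermatCubicConeChar2.self_mem_comap f P
  -- `Y₃² ∈ P'` as soon as `Y₁, Y₂ ∈ P'` and the bracket `(X3 X4⁴ + X3² X4)(1 + X2) ∈ P'`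
  have hz_of : (X 0 : MvPolynomial (Fin 5) k) ∈ P' → (X 1 : MvPolynomial (Fin 5) k) ∈ P' →
      (1 + X 2) * (X 3 * X 4 ^ 4 + X 3 ^ 2 * X 4) ∈ P' → (X 2 : MvPolynomial (Fin 5) k) ∈ P' := by
    intro hx hy hB
    have e : (X 2 : MvPolynomial (Fin 5) k) ^ 2 = f - (X 0 ^ 3 + X 1 ^ 3 + (1 + X 2) * (X 3 * X 4 ^ 4 + X 3 ^ 2 * X 4)) := by rw [hf]; ring
    have hz2 : (X 2 : MvPolynomial (Fin 5) k) ^ 2 ∈ P' := by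
      rw [e]
      exact Ideal.sub_mem _ hfP (Ideal.add_mem _ (Ideal.add_mem _ (Ideal.pow_mem_of_mem _ hx 3 (by norm_num)) (Ideal.pow_mem_of_mem _ hy 3 (by norm_num))) hB)
    exact hP'.mem_of_pow_mem 2 hz2
  by_cases h0 : (X 0 : MvPolynomial (Fin 5) k) ∉ P'
  · exact HypersurfaceRegular.stub_hypersurfaceRegularOfPderiv k 5 f 0 P (by rw [pderiv_zero_f k f hf]; exact fun h => h0 (hP'.mem_of_pow_mem 2 h))
  by_cases h1 : (X 1 : MvPolynomial (Fin 5) k) ∉ P'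
  · exact HypersurfaceRegular.stub_hypersurfaceRegularOfPderiv k 5 f 1 P (by rw [pderiv_one_f k f hf]; exact fun h => h1 (hP'.mem_of_pow_mem 2 h))
  push Not at h0 h1
  -- `1 + Y₃ ∉ P'`
  have hunit : (1 + X 2 : MvPolynomial (Fin 5) k) ∉ P' := by
    intro hu
    have hz : (X 2 : MvPolynomial (Fin 5) k) ∈ P' := hz_of h0 h1 (Ideal.mul_mem_right _ _ hu)
    have h1mem : (1 : MvPolynomial (Fin 5) k) ∈ P' := by
      have := Ideal.sub_mem _ hu hz
      rwa [add_sub_cancel_right] at this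
    exact hP'.ne_top ((Ideal.eq_top_iff_one _).mpr h1mem)
  by_cases h3 : (X 3 : MvPolynomial (Fin 5) k) ∉ P'
  · exact HypersurfaceRegular.stub_hypersurfaceRegularOfPderiv k 5 f 4 P (by
      rw [pderiv_four_f k f hf]
      exact fun h => (hP'.mem_or_mem h).elim hunit fun h' => h3 (hP'.mem_of_pow_mem 2 h'))
  by_cases h4 : (X 4 : MvPolynomial (Fin 5) k) ∉ P'
  · exact HypersurfaceRegular.stub_hypersurfaceRegularOfPderiv k 5 f 3 P (by
      rw [pderiv_three_f k f hf]
      exact fun h => (hP'.mem_or_mem h).elim hunit fun h' => h4 (hP'.mem_of_pow_mem 4 h'))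
  push Not at h3 h4
  exfalso
  apply hP
  have hz : (X 2 : MvPolynomial (Fin 5) k) ∈ P' :=
    hz_of h0 h1 (Ideal.mul_mem_left _ _ (Ideal.add_mem _ (Ideal.mul_mem_right _ _ h3) (Ideal.mul_mem_right _ _ (Ideal.pow_mem_of_mem _ h3 2 (by norm_num)))))
  rw [Ideal.span_le]
  rintro _ ⟨j, rfl⟩
  change X j ∈ P'
  fin_cases j
  · exact h0
  · exact h1
  · exact hz
  · exact h3
  · exact h4

/-- `V(f)` is integral. [folklore] -/
theorem isIntegral_g (k : Type) [Field k] [CharP k 2] (f : MvPolynomial (Fin 5) k) (hf : f = X 2 ^ 2 + X 0 ^ 3 + X 1 ^ 3 + X 3 * X 4 ^ 4 + X 3 ^ 2 * X 4 + X 2 * X 3 * X 4 ^ 4 + X 2 * X 3 ^ 2 * X 4) :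
    IsIntegral (Spec (.of (MvPolynomial (Fin 5) k ⧸ Ideal.span {f}))) := by
  haveI := isPrime_span_f k f hf
  haveI : IsDomain (MvPolynomial (Fin 5) k ⧸ Ideal.span {f}) := Ideal.Quotient.isDomain _
  infer_instance

/-! ## §2 The binders at the origin -/

/-- (H1) the origin is closed. [folklore] -/
theorem isClosed_vertex (k : Type) [Field k] (f : MvPolynomial (Fin 5) k) (hf : f = X 2 ^ 2 + X 0 ^ 3 + X 1 ^ 3 + X 3 * X 4 ^ 4 + X 3 ^ 2 * X 4 + X 2 * X 3 * X 4 ^ 4 + X 2 * X 3 ^ 2 * X 4)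
    (v : Spec (.of (MvPolynomial (Fin 5) k ⧸ Ideal.span {f})))
    (hv : v.asIdeal = Ideal.span (Set.range fun j : Fin 5 => Ideal.Quotient.mk (Ideal.span {f}) (X j))) :
    IsClosed ({v} : Set (Spec (.of (MvPolynomial (Fin 5) k ⧸ Ideal.span {f})))) :=
  DoublePointFermatCubicGerm.isClosed_origin k f (constantCoeff_f k f hf) v hv

/-- (H2) the origin is NOT regular. [cite: Hartshorne1977, I Thm. 5.1] -/
theorem vertex_not_mem_regularLocus (k : Type) [Field k] [CharP k 2] (f : MvPolynomial (Fin 5) k) (hf : f = X 2 ^ 2 + X 0 ^ 3 + X 1 ^ 3 + X 3 * X 4 ^ 4 + X 3 ^ 2 * X 4 + X 2 * X 3 * X 4 ^ 4 + X 2 * X 3 ^ 2 * X 4)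
    (v : Spec (.of (MvPolynomial (Fin 5) k ⧸ Ideal.span {f})))
    (hv : v.asIdeal = Ideal.span (Set.range fun j : Fin 5 => Ideal.Quotient.mk (Ideal.span {f}) (X j))) :
    v ∉ Scheme.regularLocus (Spec (.of (MvPolynomial (Fin 5) k ⧸ Ideal.span {f}))) := by
  classical
  refine not_mem_regularLocus_Spec_of_not_isRegularLocalRing v ?_
  refine not_isRegularLocalRing_localization_of_pderiv_eval_eq_zero (0 : Fin 5 → k) (prime_f k f hf).ne_zero ?_ ?_ v.asIdeal ?_
  · rw [MvPolynomial.eval_zero]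
    exact constantCoeff_f k f hf
  · intro i
    fin_cases i
    · simp [pderiv_zero_f k f hf]
    · simp [pderiv_one_f k f hf]
    · simp [pderiv_two_f k f hf]
    · simp [pderiv_three_f k f hf]
    · simp [pderiv_four_f k f hf]
  · rw [hv, DoublePointFermatCubicGerm.comap_origin k f (constantCoeff_f k f hf), MvPolynomial.eval_zero, Fedder.span_range_X_eq_ker]

/-- (H3) `dim 𝒪_{X,v} = 4`. [cite: Matsumura1987, Thm. 13.5] -/
theorem ringKrullDim_stalk_vertex (k : Type) [Field k] [CharP k 2] (f : MvPolynomial (Fin 5) k) (hf : f = X 2 ^ 2 + X 0 ^ 3 + X 1 ^ 3 + X 3 * X 4 ^ 4 + X 3 ^ 2 * X 4 + X 2 * X 3 * X 4 ^ 4 + X 2 * X 3 ^ 2 * X 4)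
    (v : Spec (.of (MvPolynomial (Fin 5) k ⧸ Ideal.span {f})))
    (hv : v.asIdeal = Ideal.span (Set.range fun j : Fin 5 => Ideal.Quotient.mk (Ideal.span {f}) (X j))) :
    ringKrullDim ((Spec (.of (MvPolynomial (Fin 5) k ⧸ Ideal.span {f}))).presheaf.stalk v) = (4 : ℕ) := by
  haveI : v.asIdeal.IsMaximal := by
    rw [hv]
    exact DoublePointFermatCubicGerm.isMaximal_origin k f (constantCoeff_f k f hf)
  rw [ringKrullDim_stalk_Spec_eq]
  exact HypersurfaceLocalDim.stub_hypersurfaceLocalDim k 4 f (prime_f k f hf).ne_zero v.asIdeal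

/-- Regular at every point other than the origin. [cite: Hartshorne1977, I Thm. 5.1] -/
theorem regular_of_ne_vertex (k : Type) [Field k] [CharP k 2] (f : MvPolynomial (Fin 5) k) (hf : f = X 2 ^ 2 + X 0 ^ 3 + X 1 ^ 3 + X 3 * X 4 ^ 4 + X 3 ^ 2 * X 4 + X 2 * X 3 * X 4 ^ 4 + X 2 * X 3 ^ 2 * X 4)
    (v : Spec (.of (MvPolynomial (Fin 5) k ⧸ Ideal.span {f})))
    (hv : v.asIdeal = Ideal.span (Set.range fun j : Fin 5 => Ideal.Quotient.mk (Ideal.span {f}) (X j))) :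
    ∀ y : Spec (.of (MvPolynomial (Fin 5) k ⧸ Ideal.span {f})), y ⤳ v → y ≠ v →
      y ∈ Scheme.regularLocus (Spec (.of (MvPolynomial (Fin 5) k ⧸ Ideal.span {f}))) := by
  intro y hy hne
  refine FermatCubicConeGerm.mem_regularLocus_Spec_of_isRegularLocalRing y (regular_off_vertex k f hf y.asIdeal fun hle => hne ?_)
  have h2 : y.asIdeal ≤ v.asIdeal := (PrimeSpectrum.le_iff_specializes y v).mpr hy
  exact PrimeSpectrum.ext (le_antisymm h2 (hv ▸ hle))

/-- (H4) ISOLATED. [cite: Temkin2008, §2.1] -/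
theorem regular_off_closedPoint_vertex (k : Type) [Field k] [CharP k 2] (f : MvPolynomial (Fin 5) k) (hf : f = X 2 ^ 2 + X 0 ^ 3 + X 1 ^ 3 + X 3 * X 4 ^ 4 + X 3 ^ 2 * X 4 + X 2 * X 3 * X 4 ^ 4 + X 2 * X 3 ^ 2 * X 4)
    (v : Spec (.of (MvPolynomial (Fin 5) k ⧸ Ideal.span {f})))
    (hv : v.asIdeal = Ideal.span (Set.range fun j : Fin 5 => Ideal.Quotient.mk (Ideal.span {f}) (X j))) :
    ∀ s : Spec ((Spec (.of (MvPolynomial (Fin 5) k ⧸ Ideal.span {f}))).presheaf.stalk v),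
      s ≠ closedPoint _ → s ∈ Scheme.regularLocus (Spec ((Spec (.of (MvPolynomial (Fin 5) k ⧸ Ideal.span {f}))).presheaf.stalk v)) :=
  regularLocus_Spec_stalk_of_isolated v (regular_of_ne_vertex k f hf v hv)

/-- (H5) the CM-clause at every point of `Spec 𝒪_{X,v}`. [cite: Matsumura1987, Thm. 17.4 and Thm. 17.8] -/
theorem cmCl_Spec_stalk_vertex (k : Type) [Field k] [CharP k 2] (f : MvPolynomial (Fin 5) k) (hf : f = X 2 ^ 2 + X 0 ^ 3 + X 1 ^ 3 + X 3 * X 4 ^ 4 + X 3 ^ 2 * X 4 + X 2 * X 3 * X 4 ^ 4 + X 2 * X 3 ^ 2 * X 4)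
    (v : Spec (.of (MvPolynomial (Fin 5) k ⧸ Ideal.span {f})))
    (hv : v.asIdeal = Ideal.span (Set.range fun j : Fin 5 => Ideal.Quotient.mk (Ideal.span {f}) (X j))) :
    ∀ s : Spec ((Spec (.of (MvPolynomial (Fin 5) k ⧸ Ideal.span {f}))).presheaf.stalk v),
      CMCl ((Spec ((Spec (.of (MvPolynomial (Fin 5) k ⧸ Ideal.span {f}))).presheaf.stalk v)).presheaf.stalk s) :=
  cmCl_Spec_stalk_of_isolated v (cmCl_stalk_Spec_of_cmCl_localization v
    (DoublePointFermatCubicGerm.cmCl_localization_hypersurface k f (prime_f k f hf).ne_zero v)) (regular_of_ne_vertex k f hf v hv)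

/-! ## §3 The origin is a BAD point -/

/-- `f ∈ 𝔪^{[2]}` termwise. [certificate; cite: Fedder1983, Prop. 1.7] -/
theorem f_mem_bracket (k : Type) [Field k] (f : MvPolynomial (Fin 5) k) (hf : f = X 2 ^ 2 + X 0 ^ 3 + X 1 ^ 3 + X 3 * X 4 ^ 4 + X 3 ^ 2 * X 4 + X 2 * X 3 * X 4 ^ 4 + X 2 * X 3 ^ 2 * X 4) :
    f ∈ Ideal.span (Set.range fun i : Fin 5 => (X i : MvPolynomial (Fin 5) k) ^ 2) := by
  have hsq : ∀ j : Fin 5, (X j : MvPolynomial (Fin 5) k) ^ 2 ∈ Ideal.span (Set.range fun i : Fin 5 => (X i : MvPolynomial (Fin 5) k) ^ 2) :=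
    fun j => Ideal.subset_span ⟨j, rfl⟩
  rw [hf]
  refine Ideal.add_mem _ (Ideal.add_mem _ (Ideal.add_mem _ (Ideal.add_mem _ (Ideal.add_mem _ (Ideal.add_mem _ (hsq 2) ?_) ?_) ?_) ?_) ?_) ?_
  · rw [show (X 0 : MvPolynomial (Fin 5) k) ^ 3 = X 0 ^ 2 * X 0 by ring]; exact Ideal.mul_mem_right _ _ (hsq 0)
  · rw [show (X 1 : MvPolynomial (Fin 5) k) ^ 3 = X 1 ^ 2 * X 1 by ring]; exact Ideal.mul_mem_right _ _ (hsq 1)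
  · rw [show (X 3 : MvPolynomial (Fin 5) k) * X 4 ^ 4 = X 4 ^ 2 * (X 3 * X 4 ^ 2) by ring]; exact Ideal.mul_mem_right _ _ (hsq 4)
  · rw [show (X 3 : MvPolynomial (Fin 5) k) ^ 2 * X 4 = X 3 ^ 2 * X 4 by ring]; exact Ideal.mul_mem_right _ _ (hsq 3)
  · rw [show (X 2 : MvPolynomial (Fin 5) k) * X 3 * X 4 ^ 4 = X 4 ^ 2 * (X 2 * X 3 * X 4 ^ 2) by ring]; exact Ideal.mul_mem_right _ _ (hsq 4)
  · rw [show (X 2 : MvPolynomial (Fin 5) k) * X 3 ^ 2 * X 4 = X 3 ^ 2 * (X 2 * X 4) by ring]; exact Ideal.mul_mem_right _ _ (hsq 3)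

/-- ★ **The origin of the storey-2 germ is NOT FULL** (Fedder necessity, `p = 2`). [cite: Fedder1983, Prop. 1.7] -/
theorem storey2_vertex_not_fullCl (k : Type) [Field k] [CharP k 2] (f : MvPolynomial (Fin 5) k) (hf : f = X 2 ^ 2 + X 0 ^ 3 + X 1 ^ 3 + X 3 * X 4 ^ 4 + X 3 ^ 2 * X 4 + X 2 * X 3 * X 4 ^ 4 + X 2 * X 3 ^ 2 * X 4)
    (v : Spec (.of (MvPolynomial (Fin 5) k ⧸ Ideal.span {f})))
    (hv : v.asIdeal = Ideal.span (Set.range fun j : Fin 5 => Ideal.Quotient.mk (Ideal.span {f}) (X j))) :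
    ¬ FullCl 2 ((Spec (.of (MvPolynomial (Fin 5) k ⧸ Ideal.span {f}))).presheaf.stalk v) := by
  haveI : Fact (Nat.Prime 2) := ⟨Nat.prime_two⟩
  refine HypersurfaceOriginNotFull.not_fullCl_stalk_origin_of_fedder_mem 2 k f (prime_f k f hf).ne_zero (constantCoeff_f k f hf) ?_ v hv
  rw [show (2 - 1 : ℕ) = 1 from rfl, pow_one]
  exact f_mem_bracket k f hf

end Summit.ResolutionOfSingularities.ResolutionOfSingularities.Theorems.FInjectiveMacaulayfication.FDStorey2Specimen

end
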